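import Summits.CriticalPhenomena.PercolationContinuityZ3.Theorems.PercNearOneGluingNoHeavyQuantJointBlobHull
import HarnessLib

/-!
# QUANT lane R8, T-DEC: THE REDUCIBILITY PRINCIPLE IN THE KERNEL — a forest with ONE blob-hull-reducible sibling is FREE in the sibling step
# (oracle on the rest, blob slices per hull component, common-mean mixture); `sdec_lconv_blobLaw`, `sdec_lconv_inBlobHull`,
# `sdec_siblings_of_reducible`

builds on p205010 (kernel theorem, internal audit signed; external expert review pending)

Support file (`--supports stmt-CriticalPhenomena-4575`), QUANT lane typer seat prim-quant-stmt (gen 40), rung R8 of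
`run/shared/lean/prim/quant/LADDER.md`; README V422 (b)/(c) ("REDUCIBILITY: law(τ) ∈ hull of same-mean blob forests at the forest floor ⟹ free at any
width") made a theorem ON THE NODE'S LIST BINDER, in its blob-hull form.  Theorems only, standard axioms, no sorries.  Uses typer g40's
`…QuantJointBlobHull` (`InBlobHull`, `sdec_slice'`, `sdec_blobLaw`, blob-list bookkeeping), census-2's `sdec_of_gatedSDECMixture`, typer g39's list binder.

* **`sdec_lconv_blobLaw`** — an SDEC probability law (top-affordable at `x`) joined with independent heavy blobs (gates in `[x,1]`) stays SDEC;
* **`sdec_lconv_inBlobHull`** — … joined with ANY MEMBER OF THE BLOB HULL (any mean) stays SDEC: blob slices per component, then the common-mean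
  mixture (`sdec_of_gatedSDECMixture` with unit gates);
* **`sdec_siblings_of_reducible`** — ON THE LIST BINDER: if SOME sibling's gated law `gate s.ρ s.q` lies in the blob hull at the floor (for any mean,
  top `s.M`), the oracle below `fgates L` (applied to the REST of the forest, a tree-built law with fewer gates) gives `SDEC x (ftop L) (flaw L)` — every
  width, every outer gate.  So the sibling step owes only forests ALL of whose siblings are individually hull-irreducible (with typer g40's
  JR3-NEARSURE-G40 finding that the joint hull fails for 'one irreducible + near-deterministic partners', this is the honest law-level residue:
  ≥ 3 individually irreducible, ≥ 3-relay siblings whose joint law is not a hull member, at outer gates outside the re-gating regimes).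

HONEST STATUS: `SiblingStep`, `GateStepN`, `FarTreeRow` OPEN; RATE class log\* / honest sentence unchanged.  [this work]; the principle is prim-quant-lead
g45's (README V422).  Nothing here is cited as a published result.  The gluing rows served [cite: KozmaNitzan2024, Conjecture 3 (p. 15)]; product
measure [cite: Grimmett1999, §1.3 p. 10].
-/

noncomputable section

open scoped BigOperators

namespace Summit.CriticalPhenomena.PercolationContinuityZ3.Theorems
namespace Quant
namespace LawDec

open Finset

/-- law facts of `μ ∗ blobLaw l` from those of `μ` (nonnegative, vanishing above `M + blobTop l`, mass `1`, mean `mean μ + blobMean l`). [this work] -/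
theorem lconv_blobLaw_facts {M : ℕ} {μ : ℕ → ℝ} (hμ0 : ∀ h, 0 ≤ μ h) (hμ1 : ∑ h ∈ Finset.range (M + 1), μ h = 1)
    (l : List (ℕ × ℝ)) (hl : ∀ p ∈ l, 0 ≤ p.2 ∧ p.2 ≤ 1) :
    (∀ h, 0 ≤ lconv M (blobTop l) μ (blobLaw l) h) ∧ (∀ h, M + blobTop l < h → lconv M (blobTop l) μ (blobLaw l) h = 0) ∧
      (∑ h ∈ Finset.range (M + blobTop l + 1), lconv M (blobTop l) μ (blobLaw l) h = 1) ∧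
      ∑ h ∈ Finset.range (M + blobTop l + 1), (h : ℝ) * lconv M (blobTop l) μ (blobLaw l) h
        = ∑ h ∈ Finset.range (M + 1), (h : ℝ) * μ h + blobMean l :=
  ⟨lconv_nonneg _ _ _ _ hμ0 (blobLaw_nonneg l hl), fun h hh => lconv_eq_zero _ _ _ _ h hh,
    sum_lconv _ _ _ _ hμ1 (sum_blobLaw l), by rw [sum_mul_lconv _ _ _ _ hμ1 (sum_blobLaw l), sum_mul_blobLaw]⟩

/-- **AN SDEC LAW JOINED WITH INDEPENDENT HEAVY BLOBS STAYS SDEC**: for a probability law `μ` on `{0..M}`, top-affordable and SDEC at `x ∈ (0,1)`, and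
a blob list `l` with gates in `[x, 1]`: `SDEC x (M + blobTop l) (μ ∗ blobLaw l)` (successive slices, `sdec_slice'`). [this work] -/
theorem sdec_lconv_blobLaw {x : ℝ} {M : ℕ} {μ : ℕ → ℝ} (hx0 : 0 < x) (hx1 : x < 1) (hμ0 : ∀ h, 0 ≤ μ h) (hμM : ∀ h, M < h → μ h = 0)
    (hμ1 : ∑ h ∈ Finset.range (M + 1), μ h = 1) (hta : x * (M : ℝ) ≤ ∑ h ∈ Finset.range (M + 1), (h : ℝ) * μ h) (hS : SDEC x M μ) :
    ∀ l : List (ℕ × ℝ), (∀ p ∈ l, x ≤ p.2 ∧ p.2 ≤ 1) → SDEC x (M + blobTop l) (lconv M (blobTop l) μ (blobLaw l))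
  | [], _ => by
    have e : lconv M (blobTop []) μ (blobLaw []) = μ := by
      simp only [blobTop, blobLaw]
      exact funext fun h => lconv_delta_right M 0 μ hμM h
    rw [e]; exact hS
  | p :: l, hl => by
    have hl' : ∀ p' ∈ l, x ≤ p'.2 ∧ p'.2 ≤ 1 := fun p' hp' => hl p' (List.mem_cons_of_mem p hp')
    have hg : ∀ p' ∈ l, 0 ≤ p'.2 ∧ p'.2 ≤ 1 := fun p' hp' => ⟨hx0.le.trans (hl' p' hp').1, (hl' p' hp').2⟩
    obtain ⟨hxp, hp1⟩ := hl p List.mem_cons_self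
    obtain ⟨n0, nM, n1, nmean⟩ := lconv_blobLaw_facts hμ0 hμ1 l hg
    have ih := sdec_lconv_blobLaw hx0 hx1 hμ0 hμM hμ1 hta hS l hl'
    -- `μ ∗ blobLaw (p :: l) = slice (μ ∗ blobLaw l) p.1 p.2`
    have e : lconv M (blobTop (p :: l)) μ (blobLaw (p :: l)) = slice (lconv M (blobTop l) μ (blobLaw l)) p.1 p.2 := by
      simp only [blobTop, blobLaw]
      rw [← lconv_gate_point_eq_slice (blobTop l) p.1 (blobLaw l) p.2 (fun k hk => blobLaw_eq_zero l k hk), lconv_assoc,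
        lconv_gate_point_eq_slice (M + blobTop l) p.1 _ p.2 nM]
    rw [e, show M + blobTop (p :: l) = M + blobTop l + p.1 by simp only [blobTop]; omega]
    refine sdec_slice' x p.2 (M + blobTop l) p.1 _ hx0 hx1 hxp hp1 n0 nM n1 ?_ ih
    rw [nmean, Nat.cast_add]
    have := floor_mul_blobTop_le x l fun p' hp' => (hl' p' hp').1
    nlinarith

/-- **AN SDEC LAW JOINED WITH A BLOB-HULL MEMBER STAYS SDEC**: `μ` on `{0..M}` (probability law, top-affordable, SDEC at `x ∈ (0,1)`) and
`ν ∈ K_x(m)` with top `N` (any mean `m`): `SDEC x (M + N) (μ ∗ ν)` — each component `μ ∗ blobLaw lᵢ` is SDEC (`sdec_lconv_blobLaw`), all have the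
mean `mean μ + m`, and SDEC is convex at a common mean (`sdec_of_gatedSDECMixture` with unit gates). [this work] -/
theorem sdec_lconv_inBlobHull {x m : ℝ} {M N : ℕ} {μ ν : ℕ → ℝ} (hx0 : 0 < x) (hx1 : x < 1) (hμ0 : ∀ h, 0 ≤ μ h)
    (hμM : ∀ h, M < h → μ h = 0) (hμ1 : ∑ h ∈ Finset.range (M + 1), μ h = 1)
    (hta : x * (M : ℝ) ≤ ∑ h ∈ Finset.range (M + 1), (h : ℝ) * μ h) (hS : SDEC x M μ) (hν : InBlobHull x m N ν) :
    SDEC x (M + N) (lconv M N μ ν) := by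
  have hνm := hν.mean_eq
  obtain ⟨ν0, νN, ν1⟩ := hν.lawFacts hx0.le
  obtain ⟨ι, hι, w, l, hw0, hw1, hg, htop, hmean, hmix⟩ := hν
  have hg' : ∀ i, ∀ p ∈ l i, 0 ≤ p.2 ∧ p.2 ≤ 1 := fun i p hp => ⟨hx0.le.trans (hg i p hp).1, (hg i p hp).2⟩
  have hmeanμν : ∑ h ∈ Finset.range (M + N + 1), (h : ℝ) * lconv M N μ ν h = ∑ h ∈ Finset.range (M + 1), (h : ℝ) * μ h + m := by
    rw [sum_mul_lconv _ _ _ _ hμ1 ν1, hνm]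
  refine sdec_of_gatedSDECMixture x (M + N) (lconv M N μ ν) w (fun _ => 1) (fun i => M + blobTop (l i))
    (fun i => lconv M (blobTop (l i)) μ (blobLaw (l i))) hx0 hw0 hw1 (fun _ => ⟨hx1, le_rfl⟩)
    (fun i => (lconv_blobLaw_facts hμ0 hμ1 (l i) (hg' i)).1) (fun i => (lconv_blobLaw_facts hμ0 hμ1 (l i) (hg' i)).2.1)
    (fun i => (lconv_blobLaw_facts hμ0 hμ1 (l i) (hg' i)).2.2.1) (fun i => ?_) (fun i => ?_) (fun i => by have := htop i; omega)
    (fun i => ?_) (fun h => ?_)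
  · rw [div_one, (lconv_blobLaw_facts hμ0 hμ1 (l i) (hg' i)).2.2.2, Nat.cast_add]
    have := floor_mul_blobTop_le x (l i) fun p hp => (hg i p hp).1
    nlinarith
  · rw [div_one]; exact sdec_lconv_blobLaw hx0 hx1 hμ0 hμM hμ1 hta hS (l i) (hg i)
  · rw [one_mul, (lconv_blobLaw_facts hμ0 hμ1 (l i) (hg' i)).2.2.2, hmean i, hmeanμν]
  · simp_rw [gate_one]
    have eν : ν = fun k => ∑ i, w i * blobLaw (l i) k := funext hmix
    rw [eν, lconv_fsum_right]
    refine Finset.sum_congr rfl fun i _ => ?_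
    rw [lconv_top_right_of_le M (blobTop (l i)) N μ (blobLaw (l i)) (htop i) (fun k hk => blobLaw_eq_zero _ k hk)]

/-- **THE REDUCIBILITY PRINCIPLE ON THE NODE'S LIST BINDER** (README V422): if SOME sibling `s ∈ L` has its gated law `gate s.ρ s.q` in the blob
hull at the floor (top `s.M`, any mean) then, given the node's oracle below `fgates L` — used once, on the rest of the forest, a tree-built law
with `fgates L − (s.n + 1)` gates — the forest law is SDEC at `x`: `SDEC x (ftop L) (flaw L)`, for every width.  The sibling step therefore owes only
forests all of whose siblings are individually hull-irreducible. [this work] -/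
theorem sdec_siblings_of_reducible {x : ℝ} (hx0 : 0 < x) (L : List Sib) (hL : ∀ s ∈ L, s.TreeOK x)
    (hO : ∀ (x' : ℝ) (n' M' : ℕ) (μ' : ℕ → ℝ), n' < fgates L → TreeBuiltN x' n' M' μ' → SDEC x' M' μ')
    (hred : ∃ s ∈ L, ∃ m : ℝ, InBlobHull x m s.M (gate s.ρ s.q)) : SDEC x (ftop L) (flaw L) := by
  obtain ⟨s, hs, m, hsm⟩ := hred
  obtain ⟨S, T, rfl⟩ := List.append_of_mem hs
  have hperm : (S ++ s :: T).Perm (s :: (S ++ T)) := List.perm_middle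
  rw [flaw_perm hperm, ftop_perm hperm]
  rw [fgates_perm hperm] at hO
  have hL' : ∀ t ∈ S ++ T, t.TreeOK x := fun t ht => by
    refine hL t ?_
    rw [List.mem_append] at ht ⊢
    rcases ht with ht | ht
    · exact Or.inl ht
    · exact Or.inr (List.mem_cons_of_mem s ht)
  obtain ⟨hq0, hq1, hxq, hT, _⟩ := hL s (List.mem_append_right S List.mem_cons_self)
  obtain ⟨_, hx₁1, _, _, _, _⟩ := hT.lawFacts
  have hx1 : x < 1 := (lt_of_le_of_lt hxq (by nlinarith)).trans hq1
  have hF : TreeBuiltN x (fgates (S ++ T)) (ftop (S ++ T)) (flaw (S ++ T)) := (compForestN_of_list hx0 hx1 (S ++ T) hL').treeBuiltN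
  obtain ⟨_, _, f0, fM, f1, fta⟩ := hF.lawFacts
  have hSF : SDEC x (ftop (S ++ T)) (flaw (S ++ T)) := hO x _ _ _ (by simp only [fgates]; omega) hF
  simp only [flaw, ftop]
  exact sdec_lconv_inBlobHull hx0 hx1 f0 fM f1 fta hSF hsm

/-- **a relay-law sibling is reducible**: `gate (gate δ₁ a) q = blobLaw [(1, q·a)]` lies in the hull at any floor `x ≤ q·a` (`q·a ≤ 1`). [this work] -/
theorem inBlobHull_relaySib {x q a : ℝ} (hxqa : x ≤ q * a) (hqa1 : q * a ≤ 1) {M : ℕ} (hM : 1 ≤ M) :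
    InBlobHull x (q * a) M (gate (gate (fun k : ℕ => if k = 1 then (1 : ℝ) else 0) a) q) := by
  have e : gate (gate (fun k : ℕ => if k = 1 then (1 : ℝ) else 0) a) q = blobLaw [(1, q * a)] := by
    rw [gate_gate]
    funext h
    simp only [blobLaw, slice, gate_apply]
    rcases h with _ | _ | h
    · simp
    · simp
    · rw [if_neg (show h + 1 + 1 ≠ 1 by omega), if_neg (show h + 1 + 1 ≠ 0 by omega), if_pos (show 1 ≤ h + 1 + 1 by omega),
        if_neg (show h + 1 + 1 - 1 ≠ 0 by omega)]
      ring
  have hm : blobMean [(1, q * a)] = q * a := by simp [blobMean]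
  have h := inBlobHull_blobLaw x [(1, q * a)] (fun p hp => by simp at hp; subst hp; exact ⟨hxqa, hqa1⟩) (by simpa [blobTop] using hM)
  rw [hm] at h
  rw [e]; exact h

end LawDec
end Quant
end Summit.CriticalPhenomena.PercolationContinuityZ3.Theorems
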